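import Mathlib
import HarnessLib
import Summits.HubbardSuperconductivity.HubbardSuperconductivity.Theorems.WeakCouplingBCSKlThirdOrderSelectionWindow

/-!
# Route `WeakCouplingBCS` — channel-margin lane of `WcbcsKohnLuttingerB1g` (stmt-HubbardSuperconductivity-0158): third order PLUS the
# bubble/ladder chains resummed to all orders — objects, named hypotheses, and the selection theorems

`Theorems/WeakCouplingBCSDefsKlThirdOrder.lean` / `…KlThirdOrderSelection(Window).lean` read the `U₀` rows through THIRD order
(`thirdOrderForm`).  The rows also certify the two CHAIN families to all orders (`c4B`, `s4`, uniformly on `0 < U ≤ U1`;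
Scalapino–Loh–Hirsch 1986): the crossed ladder `Σ_{n≥2} Uⁿ χ₀(k+k')ⁿ⁻¹ = U² x/(1-Ux)` and the longitudinal bubble chain
`Σ_{m≥1} U^{2m+1} χ₀(k-k')^{2m} = U³ y²/(1-U²y²)` (`x = χ₀(k+k')`, `y = χ₀(k-k')`), i.e. per `U³`: `x²/(1-Ux) + y²/(1-U²y²)`
(`= x² + y² = chainKernel3` at `U = 0`; on even `ψ` its excess over `x² + y²`, per `U⁴`, is `g₄ᵉ(U,x) = x³/(1-Ux) + Ux⁴/(1-U²x²)`, on
odd `ψ` `g₄ᵒ = x³/(1-U²x²)` — the kernels bounded by the rows' `c4B`, `s4`).  This file adds: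

* `chainKernelResummed`, `klResummedKernel U = chainKernelResummed U + T_V + T_P`, `resummedForm ε μ U ψ = (∫ψ)²/U + ⟨ψ,χ₀ψ⟩ + U⟨ψ,K_res(U)ψ⟩`
  — the form of `Γ_U/U²` through third order with both chain families resummed (the object of the rows with `C4 = 0`);
* the NAMED hypotheses `KLU0Row.B1gResummedBound` (`⟨Φ_B, K_res(U) Φ_B⟩ ≤ (c3B + tB + U c4B)‖Φ_B‖²` on `0 < U ≤ U1`),
  `KLU0Chan.ResummedLowerBound` (`⟨ψ, K_res(U) ψ⟩ ≥ -(s3 + t + U s4)`), bundled as `KLU0Row.ResummedEnclosures`, and the window bundle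
  `KlResummedWindowEnclosures`;
* `klResummed_selection_of_lower` (generic), `klResummed_selection` / `klResummed_selectionD` (one box, `basicOKB1g` / `basicOKB1gD`),
  `klResummed_selection_d010_certfloor` (record `klCertB1gD010` + certified floor row, `U0 = 1215/2²⁰`) and `klResummed_selection_window`
  (every `μ ∈ [-0.42749, -0.1775]`, threshold `klU0WindowU`), each modulo the second-order `EnclosuresB1g` and the named resummed hypotheses.

The assumed non-chain remainder of order `≥ 4` (the rows' `C4`) is NOT addressed (used only through `0 ≤ C4`).  Nothing here asserts a
pairing instability.  Cell file `run/shared/lean/pub/gate-hubbard-kl/U0-TABLE.md` v3.1.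
References: D. J. Scalapino, E. Loh, J. E. Hirsch, Phys. Rev. B 34 (1986) 8190, (3)–(4); S. Raghu, S. A. Kivelson, D. J. Scalapino,
Phys. Rev. B 81 (2010) 224505, App. A.
-/

noncomputable section

-- the tree's namespace `Summit.<Summit>.<Problem>.Theorems` repeats the summit name by design (D-0017)
set_option linter.dupNamespace false

namespace Summit.HubbardSuperconductivity.HubbardSuperconductivity.Theorems

open MeasureTheory Literature.MathematicalPhysics.QuantumLattice CwKLChiralWindow KlThirdOrder

namespace KlThirdOrder

/-- **The resummed chain kernel** per `U³` at coupling `U`: `x²/(1 - U x) + y²/(1 - U² y²)`, `x = χ₀(k+k')` (crossed ladder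
`Σ_{n≥2} Uⁿ xⁿ⁻¹`, minus its second-order term, divided by `U³`), `y = χ₀(k-k')` (longitudinal bubble chain `Σ_{m≥1} U^{2m+1} y^{2m}` divided
by `U³`); equals `chainKernel3` at `U = 0` (junk `x/0 = 0` at the poles, outside `U sup χ₀ < 1`). [cite: ScalapinoLohHirsch1986, (3)-(4)] -/
def chainKernelResummed (ε : Momentum → ℝ) (μ U : ℝ) (k k' : Momentum) : ℝ :=
  lindhardFunction ε μ (k + k') ^ 2 / (1 - U * lindhardFunction ε μ (k + k')) +
    lindhardFunction ε μ (k - k') ^ 2 / (1 - U ^ 2 * lindhardFunction ε μ (k - k') ^ 2)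

/-- The kernel of `Γ_U/U²` beyond second order, per `U`, with the chains resummed: `K_res(U) = chainKernelResummed U + T_V + T_P`
(`= K₃` at `U = 0`). [cite: ScalapinoLohHirsch1986, (3)-(4)] -/
def klResummedKernel (ε : Momentum → ℝ) (μ U : ℝ) (k k' : Momentum) : ℝ :=
  chainKernelResummed ε μ U k k' + twoLoopV ε μ k k' + twoLoopP ε μ k k'

/-- **The chain-resummed truncated vertex form** `(∫ψ dσ_μ)²/U + ⟨ψ, χ₀(k+k') ψ⟩ + U ⟨ψ, K_res(U) ψ⟩`: the quadratic form of `Γ_U/U²` with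
the two-loop third-order diagrams and BOTH chain families to all orders (meant for `0 < U`, `U sup χ₀ < 1`).
[cite: ScalapinoLohHirsch1986, (3)-(4)] -/
def resummedForm (ε : Momentum → ℝ) (μ U : ℝ) (ψ : Momentum → ℝ) : ℝ :=
  (∫ k, ψ k ∂fermiCurveMeasure ε μ) ^ 2 / U + kform (fermiCurveMeasure ε μ) (lindhardKernel ε μ) ψ +
    U * kform (fermiCurveMeasure ε μ) (klResummedKernel ε μ U) ψ

/-- At `U = 0` the resummed chain kernel is the third-order chain kernel. [folklore] -/
theorem chainKernelResummed_zero (ε : Momentum → ℝ) (μ : ℝ) (k k' : Momentum) :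
    chainKernelResummed ε μ 0 k k' = chainKernel3 ε μ k k' := by
  simp [chainKernelResummed, chainKernel3, add_comm]

end KlThirdOrder

/-! ### Named hypotheses (square-lattice band `ε₀ = squareDispersion 1 0`) -/

/-- **`B1g`-side resummed hypothesis of a row** at the level `μ`, for the record's `B1g` trial `Φ`: for every `0 < U ≤ U1`,
`⟨Φ, K_res(U) Φ⟩ ≤ (c3B + tB + U c4B) ∫Φ² dσ_μ` (third-order chains `c3B`, two-loop allowance `tB`, chains of order `≥ 4` per `U⁴`: `c4B`,
certified uniformly on `U ≤ U1` from the monotone envelopes `g₄ᵉ`). [folklore] -/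
def KLU0Row.B1gResummedBound (r : KLU0Row) (μ : ℝ) (Φ : Momentum → ℝ) : Prop :=
  ∀ U : ℝ, 0 < U → U ≤ r.U1 →
    kform (fermiCurveMeasure (squareDispersion 1 0) μ) (klResummedKernel (squareDispersion 1 0) μ U) Φ ≤
      ((((r.c3B + r.tB : ℚ) : ℝ)) + U * (r.c4B : ℝ)) * ∫ k, Φ k ^ 2 ∂fermiCurveMeasure (squareDispersion 1 0) μ

/-- **Competitor-side resummed hypothesis of a channel datum** `c` in the channel `χ` at the level `μ`, on `0 < U ≤ U1`: on every normalised
channel state, `⟨ψ, K_res(U) ψ⟩ ≥ -(s3 + t + U s4)`. [folklore] -/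
def KLU0Chan.ResummedLowerBound (c : KLU0Chan) (U1 : ℚ) (μ : ℝ) (χ : D4Irrep) : Prop :=
  ∀ U : ℝ, 0 < U → U ≤ U1 → ∀ ψ : Momentum → ℝ, IsChannelState (squareDispersion 1 0) μ χ ψ →
    -((((c.s3 + c.t : ℚ) : ℝ)) + U * (c.s4 : ℝ)) ≤
      kform (fermiCurveMeasure (squareDispersion 1 0) μ) (klResummedKernel (squareDispersion 1 0) μ U) ψ

/-- **The named resummed hypotheses of a row at the level `μ`** (`B1g` side for the trial `Φ`; the four competitors through `chanOf`).
[folklore] -/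
def KLU0Row.ResummedEnclosures (r : KLU0Row) (μ : ℝ) (Φ : Momentum → ℝ) : Prop :=
  r.B1gResummedBound μ Φ ∧ ∀ χ : D4Irrep, χ ≠ D4Irrep.B1g → (r.chanOf χ).ResummedLowerBound r.U1 μ χ

/-- **The named resummed hypotheses of a window of rows** against second-order records (as `KlThirdOrderWindowEnclosures`). [folklore] -/
def KlResummedWindowEnclosures (rows : List KLU0WinRow) (recs : List KLCert) : Prop :=
  ∀ w ∈ rows, ∀ c ∈ recs, ∀ bx ∈ c.boxes, bx.mulo ≤ w.mulo → w.muhi ≤ bx.muhi → w.row.dominates bx c.trials = true →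
    ∀ μ : ℝ, ((w.mulo : ℚ) : ℝ) ≤ μ → μ ≤ ((w.muhi : ℚ) : ℝ) →
      w.row.ResummedEnclosures μ (bx.bB1g.trialFun c.trials)

/-! ### The row through the resummed chains, and the selection theorems -/

/-- **A row with the chains resummed.** If `r.ok` and `c ∈ r.chans`, then for `0 < U ≤ U0`:
`rhohi + U(c3B+tB) + U² c4B < low - U(s3+t) - U² s4` (`klU0Row_sound`; `C4` enters only through `0 ≤ C4`). [folklore] -/
theorem klto_row_resummed (r : KLU0Row) (hr : r.ok = true) (c : KLU0Chan) (hc : c ∈ r.chans) :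
    ∀ U : ℝ, 0 < U → U ≤ r.U0 →
      (r.rhohi : ℝ) + U * ((r.c3B : ℝ) + r.tB) + U ^ 2 * (r.c4B : ℝ) <
        (c.low : ℝ) - U * ((c.s3 : ℝ) + c.t) - U ^ 2 * (c.s4 : ℝ) := by
  have hr' := hr
  simp only [KLU0Row.ok, KLU0Row.endpoint, Bool.and_eq_true, decide_eq_true_eq, List.all_eq_true] at hr'
  obtain ⟨⟨⟨⟨-, -⟩, -⟩, hC4⟩, -⟩ := hr'
  refine klU0Row_sound r hr c hc (fun U => (r.rhohi : ℝ) + U * ((r.c3B : ℝ) + r.tB) + U ^ 2 * (r.c4B : ℝ))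
    (fun U => (c.low : ℝ) - U * ((c.s3 : ℝ) + c.t) - U ^ 2 * (c.s4 : ℝ)) (fun U hU _ => ?_) (fun U hU _ => ?_)
  · have h2 : (0 : ℝ) ≤ r.C4 := by exact_mod_cast hC4
    nlinarith [sq_nonneg U]
  · have h2 : (0 : ℝ) ≤ r.C4 := by exact_mod_cast hC4
    nlinarith [sq_nonneg U]

/-- **Two-sided bounds with the chains resummed.** As `klThirdOrder_bounds`, with `resummedForm` and the named resummed hypotheses:
`resummedForm ε₀ μ U ψ_B ≤ rhohi + U(c3B+tB) + U² c4B` and `low - U(s3+t) - U² s4 ≤ resummedForm ε₀ μ U φ` on `0 < U ≤ U1` (`U1 ≤ 1`).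
[folklore] -/
theorem klResummed_bounds {μ : ℝ} (hμ : μ ∈ Set.Ioo (-4 : ℝ) 0) (bx : KLBox) (tab : List KLTrig)
    (hritz : bx.bB1g.ritzOK tab D4Irrep.B1g = true) (hER : bx.bB1g.RitzEnclosure tab μ)
    (hlower : ∀ χ : D4Irrep, χ ≠ D4Irrep.B1g →
      (((bx.blk χ).lower tab χ : ℚ) : ℝ) ≤ channelInf (squareDispersion 1 0) μ 1 χ)
    (r : KLU0Row) (hdom : r.dominates bx tab = true)
    (h3 : r.ResummedEnclosures μ (bx.bB1g.trialFun tab)) :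
    ∃ ψ : Momentum → ℝ, IsChannelState (squareDispersion 1 0) μ D4Irrep.B1g ψ ∧
      (∀ U : ℝ, 0 < U → U ≤ r.U1 →
        resummedForm (squareDispersion 1 0) μ U ψ ≤ (r.rhohi : ℝ) + U * ((r.c3B : ℝ) + r.tB) + U ^ 2 * (r.c4B : ℝ)) ∧
      (∀ U : ℝ, 0 < U → U ≤ r.U1 → ∀ χ : D4Irrep, χ ≠ D4Irrep.B1g →
        ∀ φ : Momentum → ℝ, IsChannelState (squareDispersion 1 0) μ χ φ →
          ((r.chanOf χ).low : ℝ) - U * (((r.chanOf χ).s3 : ℝ) + (r.chanOf χ).t) - U ^ 2 * ((r.chanOf χ).s4 : ℝ) ≤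
            resummedForm (squareDispersion 1 0) μ U φ) := by
  obtain ⟨hrho, -, hU1, hlow⟩ := klto_dominates_spec r bx tab hdom
  obtain ⟨h3B, h3χ⟩ := h3
  set σ := fermiCurveMeasure (squareDispersion 1 0) μ with hσ
  set Φ : Momentum → ℝ := bx.bB1g.trialFun tab with hΦ
  obtain ⟨c, hc2, hc2N, hstate, hmean, hform2⟩ := klto_b1g_ritz_state hμ bx.bB1g tab hritz hER
  refine ⟨fun k => c * Φ k, hstate, fun U hU hUU => ?_, fun U hU hUU χ hχ φ hφ => ?_⟩
  · have h := h3B U hU hUU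
    have hform3 : kform σ (klResummedKernel (squareDispersion 1 0) μ U) (fun k => c * Φ k) ≤
        ((r.c3B + r.tB : ℚ) : ℝ) + U * (r.c4B : ℝ) := by
      calc kform σ (klResummedKernel (squareDispersion 1 0) μ U) (fun k => c * Φ k)
          = c ^ 2 * kform σ (klResummedKernel (squareDispersion 1 0) μ U) Φ := kform_smul σ _ Φ c
        _ ≤ c ^ 2 * ((((r.c3B + r.tB : ℚ) : ℝ) + U * (r.c4B : ℝ)) * ∫ k, Φ k ^ 2 ∂σ) := mul_le_mul_of_nonneg_left h hc2.le
        _ = (((r.c3B + r.tB : ℚ) : ℝ) + U * (r.c4B : ℝ)) * (c ^ 2 * ∫ k, Φ k ^ 2 ∂σ) := by ring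
        _ = ((r.c3B + r.tB : ℚ) : ℝ) + U * (r.c4B : ℝ) := by rw [hc2N, mul_one]
    unfold resummedForm
    rw [hmean]
    have h1 : ((bx.bB1g.rhohi : ℚ) : ℝ) ≤ r.rhohi := by exact_mod_cast hrho
    have h2 : U * kform σ (klResummedKernel (squareDispersion 1 0) μ U) (fun k => c * Φ k) ≤
        U * (((r.c3B + r.tB : ℚ) : ℝ) + U * (r.c4B : ℝ)) := mul_le_mul_of_nonneg_left hform3 hU.le
    push_cast at h2
    have h0 : (0 : ℝ) ^ 2 / U = 0 := by simp
    nlinarith [hform2]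
  · have hUle1 : U ≤ 1 := le_trans hUU (by exact_mod_cast hU1)
    have hlo2 := klto_competitor_lower hμ χ (hlower χ hχ) φ hφ
    have hlo3 := h3χ χ hχ U hU hUU φ hφ
    have hlowq : (((r.chanOf χ).low : ℚ) : ℝ) ≤ ((bx.blk χ).lower tab χ : ℝ) := by exact_mod_cast hlow χ hχ
    unfold resummedForm
    have hsq : (∫ k, φ k ∂σ) ^ 2 ≤ (∫ k, φ k ∂σ) ^ 2 / U := by
      rw [le_div_iff₀ hU]
      have := sq_nonneg (∫ k, φ k ∂σ)
      nlinarith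
    have h2 : U * -((((r.chanOf χ).s3 + (r.chanOf χ).t : ℚ) : ℝ) + U * ((r.chanOf χ).s4 : ℝ)) ≤
        U * kform σ (klResummedKernel (squareDispersion 1 0) μ U) φ := mul_le_mul_of_nonneg_left hlo3 hU.le
    push_cast at h2
    nlinarith

/-- **`B1g` selection with the chains resummed** (generic form): for `0 < U ≤ r.U0` the normalised `B1g` trial lies strictly below every
normalised competitor state in `resummedForm ε₀ μ U`. [cite: ScalapinoLohHirsch1986, (3)-(4)] -/
theorem klResummed_selection_of_lower {μ : ℝ} (hμ : μ ∈ Set.Ioo (-4 : ℝ) 0) (bx : KLBox) (tab : List KLTrig)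
    (hritz : bx.bB1g.ritzOK tab D4Irrep.B1g = true) (hER : bx.bB1g.RitzEnclosure tab μ)
    (hlower : ∀ χ : D4Irrep, χ ≠ D4Irrep.B1g →
      (((bx.blk χ).lower tab χ : ℚ) : ℝ) ≤ channelInf (squareDispersion 1 0) μ 1 χ)
    (r : KLU0Row) (hr : r.ok = true) (hdom : r.dominates bx tab = true)
    (h3 : r.ResummedEnclosures μ (bx.bB1g.trialFun tab)) :
    ∃ ψ : Momentum → ℝ, IsChannelState (squareDispersion 1 0) μ D4Irrep.B1g ψ ∧
      ∀ U : ℝ, 0 < U → U ≤ r.U0 → ∀ χ : D4Irrep, χ ≠ D4Irrep.B1g →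
        ∀ φ : Momentum → ℝ, IsChannelState (squareDispersion 1 0) μ χ φ →
          resummedForm (squareDispersion 1 0) μ U ψ < resummedForm (squareDispersion 1 0) μ U φ := by
  obtain ⟨-, hlen, -, -⟩ := klto_dominates_spec r bx tab hdom
  have hr' := hr
  simp only [KLU0Row.ok, Bool.and_eq_true, decide_eq_true_eq] at hr'
  obtain ⟨⟨⟨⟨-, hU01⟩, -⟩, -⟩, -⟩ := hr'
  obtain ⟨ψ, hψ, hup, hdown⟩ := klResummed_bounds hμ bx tab hritz hER hlower r hdom h3
  refine ⟨ψ, hψ, fun U hU hUU χ hχ φ hφ => ?_⟩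
  have hUU1 : U ≤ (r.U1 : ℝ) := le_trans hUU (by exact_mod_cast hU01)
  have hrow := klto_row_resummed r hr (r.chanOf χ) (klto_chanOf_mem r hlen χ hχ) U hU hUU
  linarith [hup U hU hUU1, hdown U hU hUU1 χ hχ φ hφ]

/-- **`B1g` selection with the chains resummed, one box of a record passing `basicOKB1g`.** [cite: ScalapinoLohHirsch1986, (3)-(4)] -/
theorem klResummed_selection {μ : ℝ} (hμ : μ ∈ Set.Ioo (-4 : ℝ) 0) (bx : KLBox) (tab : List KLTrig)
    (hB : bx.basicOKB1g tab = true) (hER : bx.bB1g.RitzEnclosure tab μ)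
    (hE : ∀ χ : D4Irrep, χ ≠ D4Irrep.B1g → (bx.blk χ).Enclosure tab μ χ)
    (r : KLU0Row) (hr : r.ok = true) (hdom : r.dominates bx tab = true)
    (h3 : r.ResummedEnclosures μ (bx.bB1g.trialFun tab)) :
    ∃ ψ : Momentum → ℝ, IsChannelState (squareDispersion 1 0) μ D4Irrep.B1g ψ ∧
      ∀ U : ℝ, 0 < U → U ≤ r.U0 → ∀ χ : D4Irrep, χ ≠ D4Irrep.B1g →
        ∀ φ : Momentum → ℝ, IsChannelState (squareDispersion 1 0) μ χ φ →
          resummedForm (squareDispersion 1 0) μ U ψ < resummedForm (squareDispersion 1 0) μ U φ := by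
  obtain ⟨hritz, hlower⟩ := klto_lower_of_basicOKB1g hμ bx tab hB hE
  exact klResummed_selection_of_lower hμ bx tab hritz hER hlower r hr hdom h3

/-- **`B1g` selection with the chains resummed, one box of a multiplicity-aware record (`basicOKB1gD`).** [cite: ScalapinoLohHirsch1986, (3)-(4)] -/
theorem klResummed_selectionD {μ : ℝ} (hμ : μ ∈ Set.Ioo (-4 : ℝ) 0) (bx : KLBox) (tab : List KLTrig)
    (hB : bx.basicOKB1gD tab = true) (hER : bx.bB1g.RitzEnclosure tab μ)
    (hE : ∀ χ : D4Irrep, χ ≠ D4Irrep.B1g → (bx.blk χ).Enclosure tab μ χ)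
    (r : KLU0Row) (hr : r.ok = true) (hdom : r.dominates bx tab = true)
    (h3 : r.ResummedEnclosures μ (bx.bB1g.trialFun tab)) :
    ∃ ψ : Momentum → ℝ, IsChannelState (squareDispersion 1 0) μ D4Irrep.B1g ψ ∧
      ∀ U : ℝ, 0 < U → U ≤ r.U0 → ∀ χ : D4Irrep, χ ≠ D4Irrep.B1g →
        ∀ φ : Momentum → ℝ, IsChannelState (squareDispersion 1 0) μ χ φ →
          resummedForm (squareDispersion 1 0) μ U ψ < resummedForm (squareDispersion 1 0) μ U φ := by
  obtain ⟨hritz, hlower⟩ := klto_lower_of_basicOKB1gD hμ bx tab hB hE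
  exact klResummed_selection_of_lower hμ bx tab hritz hER hlower r hr hdom h3

/-- **`B1g` selection survives third order AND the resummed chains at `δ ≈ 0.10` for `0 < U ≤ 1215/2²⁰`**, modulo
`klCertB1gD010.EnclosuresB1g` and the certified-floor row's `ResummedEnclosures μ₀ Φ_B` (chains: kit j247393/j247690, envelopes on `U ≤ 3/10`;
two-loop floor U0-TABLE v2 §3b).  Existence-grade; nothing here asserts a pairing instability. [cite: ScalapinoLohHirsch1986, (3)-(4)] -/
theorem klResummed_selection_d010_certfloor (hE : klCertB1gD010.EnclosuresB1g) :
    ∀ bx ∈ klCertB1gD010.boxes,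
      klU0_d010_certfloor_nc16384_2loop_C4_0.ResummedEnclosures ((bx.mulo : ℚ) : ℝ)
          (bx.bB1g.trialFun klCertB1gD010.trials) →
        ∃ ψ : Momentum → ℝ, IsChannelState (squareDispersion 1 0) ((bx.mulo : ℚ) : ℝ) D4Irrep.B1g ψ ∧
          ∀ U : ℝ, 0 < U → U ≤ 1215 / 1048576 → ∀ χ : D4Irrep, χ ≠ D4Irrep.B1g →
            ∀ φ : Momentum → ℝ, IsChannelState (squareDispersion 1 0) ((bx.mulo : ℚ) : ℝ) χ φ →
              resummedForm (squareDispersion 1 0) ((bx.mulo : ℚ) : ℝ) U ψ <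
                resummedForm (squareDispersion 1 0) ((bx.mulo : ℚ) : ℝ) U φ := by
  intro bx hbx h3
  have hall := List.all_eq_true.1 klCertB1gD010_boxes_all bx hbx
  simp only [Bool.and_eq_true] at hall
  have hB := hall.1
  have hB' := hB
  simp only [KLBox.basicOKB1g, Bool.and_eq_true, decide_eq_true_eq] at hB'
  obtain ⟨⟨⟨⟨⟨⟨⟨h4, hle⟩, h0⟩, -⟩, -⟩, -⟩, -⟩, -⟩ := hB'
  have hμI : ((bx.mulo : ℚ) : ℝ) ∈ Set.Icc ((bx.mulo : ℚ) : ℝ) ((bx.muhi : ℚ) : ℝ) :=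
    ⟨le_rfl, by exact_mod_cast hle⟩
  have hμ : ((bx.mulo : ℚ) : ℝ) ∈ Set.Ioo (-4 : ℝ) 0 :=
    ⟨by exact_mod_cast h4, lt_of_le_of_lt (by exact_mod_cast hle : ((bx.mulo : ℚ) : ℝ) ≤ bx.muhi) (by exact_mod_cast h0)⟩
  obtain ⟨hER, hEχ⟩ := hE bx hbx _ hμI
  obtain ⟨ψ, hψ, h⟩ := klResummed_selection hμ bx klCertB1gD010.trials hB hER hEχ _
    klU0_d010_certfloor_nc16384_2loop_C4_0_ok (List.all_eq_true.1 klto_d010_certfloor_dominates bx hbx) h3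
  refine ⟨ψ, hψ, fun U hU hUU => h U hU ?_⟩
  have hU0 : klU0_d010_certfloor_nc16384_2loop_C4_0.U0 = (1215 : ℚ) / 1048576 := rfl
  rw [hU0]
  push_cast
  exact hUU

/-- **`B1g` selection survives third order AND the resummed chains on the WHOLE window** `μ ∈ [-0.42749, -0.1775]` for
`0 < U ≤ klU0WindowU = 1145/2²⁴`, modulo `klCertB1gWin{A,B,C}.EnclosuresB1g` and
`KlResummedWindowEnclosures klU0WindowRows [klCertB1gWinA, klCertB1gWinB, klCertB1gWinC]` (certified on every box, chains with `U1 = 1/16`,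
U0-TABLE v3 §2–§4).  Existence-grade; nothing here asserts a pairing instability. [cite: ScalapinoLohHirsch1986, (3)-(4)] -/
theorem klResummed_selection_window (hA : klCertB1gWinA.EnclosuresB1g) (hB : klCertB1gWinB.EnclosuresB1g)
    (hC : klCertB1gWinC.EnclosuresB1g)
    (h3 : KlResummedWindowEnclosures klU0WindowRows [klCertB1gWinA, klCertB1gWinB, klCertB1gWinC]) :
    ∀ μ : ℝ, ((((-42749 : ℚ) / 100000) : ℚ) : ℝ) ≤ μ → μ ≤ ((((-71 : ℚ) / 400) : ℚ) : ℝ) →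
      ∃ ψ : Momentum → ℝ, IsChannelState (squareDispersion 1 0) μ D4Irrep.B1g ψ ∧
        ∀ U : ℝ, 0 < U → U ≤ ((klU0WindowU : ℚ) : ℝ) → ∀ χ : D4Irrep, χ ≠ D4Irrep.B1g →
          ∀ φ : Momentum → ℝ, IsChannelState (squareDispersion 1 0) μ χ φ →
            resummedForm (squareDispersion 1 0) μ U ψ < resummedForm (squareDispersion 1 0) μ U φ := by
  intro μ hμ₁ hμ₂
  obtain ⟨-, hcov⟩ := klU0Win_cover _ _ _ _ klU0WindowRows_check
  obtain ⟨w, hw, hlo, hhi, hok, hu⟩ := hcov μ hμ₁ hμ₂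
  obtain ⟨c, hc, bx, hbx, hcl, hch, hdom⟩ := klThirdOrderWindowJoin_spec _ _ klto_window_join w hw
  obtain ⟨hcheckc, hEc⟩ := klto_window_recs hA hB hC c hc
  obtain ⟨-, hboxes, -⟩ := klb1gd_coverLogic c hcheckc
  obtain ⟨hBx, -⟩ := hboxes bx hbx
  have hB' := hBx
  simp only [KLBox.basicOKB1gD, Bool.and_eq_true, decide_eq_true_eq] at hB'
  obtain ⟨⟨⟨⟨⟨⟨⟨h4, -⟩, h0⟩, -⟩, -⟩, -⟩, -⟩, -⟩ := hB'
  have hlo' : ((bx.mulo : ℚ) : ℝ) ≤ μ := le_trans (by exact_mod_cast hcl) hlo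
  have hhi' : μ ≤ ((bx.muhi : ℚ) : ℝ) := le_trans hhi (by exact_mod_cast hch)
  have hμ : μ ∈ Set.Ioo (-4 : ℝ) 0 :=
    ⟨lt_of_lt_of_le (by exact_mod_cast h4) hlo', lt_of_le_of_lt hhi' (by exact_mod_cast h0)⟩
  obtain ⟨hER, hEχ⟩ := hEc bx hbx μ ⟨hlo', hhi'⟩
  have h3w := h3 w hw c hc bx hbx hcl hch hdom μ hlo hhi
  obtain ⟨ψ, hψ, hsel⟩ := klResummed_selectionD hμ bx c.trials hBx hER hEχ w.row hok hdom h3w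
  exact ⟨ψ, hψ, fun U hU hUu => hsel U hU (le_trans hUu (by exact_mod_cast hu))⟩

end Summit.HubbardSuperconductivity.HubbardSuperconductivity.Theorems

end
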